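import Summits.CriticalPhenomena.PercolationContinuityZ3.Theorems.Transplant.SkelPhiCellsSmallMS
import Summits.CriticalPhenomena.PercolationContinuityZ3.Theorems.Transplant.KNCells2RootChain
import Summits.CriticalPhenomena.PercolationContinuityZ3.Theorems.Transplant.SkelPhiWindowSpansCoarse
import HarnessLib

/-!
# N2 (frames-only node `SamePDropOfSkeletonFrm₁`, OPEN), (R) column, the (R)-ONLY rows at the ROOT CELL of the staggered scheme of record —
# **a graph ball about the root lies in the root cube `Q_{0,0}` and in the root world** (`Skelφ.subset_Q00_of_ballS`, `subset_U0rootBall_of_ballS`)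

For the scheme `⟨cellGeomSG₂bS G ψ P w₀ Λ b₀, q, δc⟩` (hp-8 g40, SkelPhiCellsSmallMS) over ANY 1-Lipschitz planar map `ψ` with `ψ w₀ = 0` (for the chain of record:
`ψ := fineOA …`, `fineA_base_at`, `lip_fineA_at`): a finite set `B ⊆ B_G(w₀, Rl)` every vertex of which has a `G`-neighbour lies in the root cube
`Q_{0,0} = VWin ψ w₀ (P.Q 0) (Λ.rQ 0 0)` as soon as `Rl + 2 ≤ Λ.rQ 0 0` and `Rl + 1 ≤ 5 r_i` (footprints within `Rl (+1)` of `ψ w₀ = 0 = cenS 0`, the span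
device `mem_VWin_of_adj`), hence in the root world `U0root du = Q_{0,0} ∪ E_{0,0,du}` cut to `B_G(w₀, R)` for `Rl ≤ R`.  These discharge the (R) root leg's
seed rows `hZQ` (`B :=` the zone at the root `Λc w₀ kz ⊆ B_G(w₀, Rs)`) and hop-prism row `hQU` (`B :=` the long-link prism at the root, radius `Rl`) of
`Skelφ.rootChainF_of_kgCorrE/_YE` (SkelPhiRootLegKGE), leaving two radius rows each (`Rs + 2 ≤ rQ 0 0`, `Rs + 1 ≤ 5 r_i`; same with `Rl`).
builds on p205010 (kernel theorem, internal audit signed; external expert review pending) — nothing in this file uses p205010; nothing here is a claim about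
the open node `SamePDropOfSkeletonFrm₁`.
Lane `prim-bschramm`, seat `prim-bschramm-p3` (gen 16; N2 design owner, (R) column owner); helper file (`--supports stmt-CriticalPhenomena-4575 --as helper`).
[cite: KozmaNitzan2024, §4 p. 27 (G₀: the wired root cube), p. 28 ((32) at the root)]
-/

noncomputable section

open scoped Classical

namespace Summit.CriticalPhenomena.PercolationContinuityZ3.Theorems

namespace Transplant

namespace Skelφ

open Literature.Probability.Percolation Literature.Probability.LatticeModels SimpleGraph KNCells
open Literature.Barriers.CriticalPhenomena (graphBall graphBall_mono mem_graphBall_self)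
open BoxProdZ2 (ConcRadiiG)

variable {V : Type} [DecidableEq V] {G : SimpleGraph V} [G.LocallyFinite] {ψ : V → Site 2}

/-- A footprint within `n` of the root's (`ψ w₀ = 0`) lies in the planar root box `P.Q 0` when `n ≤ 5 r_i`. [folklore] -/
theorem mem_Q_zero_of_abs_le (P : PCells2S) {z : Site 2} {n : ℕ} (hz : ∀ i, |z i| ≤ (n : ℤ)) (hn : ∀ i, n ≤ 5 * P.r i) : z ∈ PCells2S.Q P 0 := by
  rw [PCells2S.Q, PCells2S.cenS_zero, Finset.mem_Icc]
  refine ⟨fun i => ?_, fun i => ?_⟩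
  · have h1 := hz i; have h2 := hn i
    simp only [Pi.sub_apply, Pi.zero_apply, PCells2.hw_apply, zero_sub]
    have h3 : ((5 * P.r i : ℕ) : ℤ) ≥ (n : ℤ) := by exact_mod_cast h2
    linarith [abs_le.1 h1]
  · have h1 := hz i; have h2 := hn i
    simp only [Pi.add_apply, Pi.zero_apply, PCells2.hw_apply, zero_add]
    have h3 : ((5 * P.r i : ℕ) : ℤ) ≥ (n : ℤ) := by exact_mod_cast h2
    linarith [abs_le.1 h1]

/-- **A GRAPH BALL ABOUT THE ROOT LIES IN THE ROOT CUBE `Q_{0,0}`** of `cellGeomSG₂bS G ψ P w₀ Λ b₀`: `B ⊆ B_G(w₀, Rl)`, every vertex of `B` has a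
`G`-neighbour, `ψ` 1-Lipschitz with `ψ w₀ = 0`, `Rl + 2 ≤ Λ.rQ 0 0`, `Rl + 1 ≤ 5 r_i`. [cite: KozmaNitzan2024, §4 p. 27 (G₀)] -/
theorem subset_Q00_of_ballS (hlip : Lip G ψ) {w₀ : V} (hψ0 : ψ w₀ = 0) (P : PCells2S) (Λ : ConcRadiiG) (b₀ : Fin 2 → ℕ) {B : Finset V} {Rl : ℕ}
    (hB : ∀ u ∈ B, u ∈ graphBall G w₀ Rl) (hnb : ∀ u ∈ B, ∃ w, G.Adj u w) (hRQ : Rl + 2 ≤ Λ.rQ 0 0) (hR5 : ∀ i, Rl + 1 ≤ 5 * P.r i) :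
    B ⊆ (cellGeomSG₂bS G ψ P w₀ Λ b₀).Q 0 0 := by
  intro u hu
  obtain ⟨w, hw⟩ := hnb u hu
  have huR := hB u hu
  have hwR : w ∈ graphBall G w₀ (Rl + 1) := BoxProdZ2.mem_graphBall_succ_of_adj G huR hw
  have hψu : ∀ i, |ψ u i| ≤ ((Rl + 1 : ℕ) : ℤ) := fun i => by
    have h := abs_sub_le_of_mem_graphBall hlip (graphBall_mono G w₀ (Nat.le_succ Rl) huR) i
    rwa [hψ0, Pi.zero_apply, sub_zero] at h
  have hψw : ∀ i, |ψ w i| ≤ ((Rl + 1 : ℕ) : ℤ) := fun i => by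
    have h := abs_sub_le_of_mem_graphBall hlip hwR i
    rwa [hψ0, Pi.zero_apply, sub_zero] at h
  change u ∈ VWin G ψ w₀ (PCells2S.Q P 0) (Λ.rQ 0 0)
  exact mem_VWin_of_adj (n := Rl + 1) (graphBall_mono G w₀ (Nat.le_succ Rl) huR) (by omega) (mem_Q_zero_of_abs_le P hψu hR5) hw
    (mem_Q_zero_of_abs_le P hψw hR5)

/-- **… AND IN THE ROOT WORLD CUT TO THE WINDOW BALL**: for the scheme `S = ⟨cellGeomSG₂bS …, q, δc⟩` and `Rl ≤ R`,
`B ⊆ (Q_{0,0} ∪ E_{0,0,du}) ∩ B_G(w₀, R)` (the rows `hZR`/`hQU` of the root leg). [cite: KozmaNitzan2024, §4 p. 28 ((32) at the root)] -/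
theorem subset_U0rootBall_of_ballS (hlip : Lip G ψ) {w₀ : V} (hψ0 : ψ w₀ = 0) (P : PCells2S) (Λ : ConcRadiiG) (b₀ : Fin 2 → ℕ) (q : unitInterval) (δc : ℝ)
    (du : MDir) {B : Finset V} {Rl R : ℕ} (hB : ∀ u ∈ B, u ∈ graphBall G w₀ Rl) (hnb : ∀ u ∈ B, ∃ w, G.Adj u w) (hRQ : Rl + 2 ≤ Λ.rQ 0 0)
    (hR5 : ∀ i, Rl + 1 ≤ 5 * P.r i) (hRl : Rl ≤ R) :
    B ⊆ ((⟨cellGeomSG₂bS G ψ P w₀ Λ b₀, q, δc⟩ : KSchA V ℕ).U0root du).filter fun y => y ∈ graphBall G w₀ R := by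
  intro u hu
  refine Finset.mem_filter.2 ⟨Finset.mem_union_left _ ?_, graphBall_mono G w₀ hRl (hB u hu)⟩
  exact subset_Q00_of_ballS hlip hψ0 P Λ b₀ hB hnb hRQ hR5 hu

omit [DecidableEq V] [G.LocallyFinite] in
/-- **A vertex joined to a second vertex inside a set has a neighbour IN the set** (for the zone at the root: internally connected and not a singleton, so
`hnb` holds with the neighbour inside the zone). [folklore] -/
theorem exists_adj_mem_of_pathIn_ne {A : Set V} {u v : V} (h : PathIn G A u v) (hne : u ≠ v) : ∃ b ∈ A, G.Adj v b := by
  obtain ⟨huA, hr⟩ := h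
  rcases Relation.ReflTransGen.cases_tail hr with rfl | ⟨b, hub, hbv, -⟩
  · exact absurd rfl hne
  · exact ⟨b, PathIn.right_mem (G := G) (A := A) ⟨huA, hub⟩, hbv.symm⟩

omit [DecidableEq V] [G.LocallyFinite] in
/-- **Every vertex of an internally connected set with two vertices has a neighbour in the set.** [folklore] -/
theorem exists_adj_of_conn {A : Finset V} {c : V} (hconn : ∀ s ∈ A, PathIn G (↑A : Set V) c s) (h2 : ∃ a ∈ A, a ≠ c) :
    ∀ u ∈ A, ∃ w, G.Adj u w := by
  intro u hu
  by_cases huc : u = c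
  · subst huc
    obtain ⟨a, ha, hac⟩ := h2
    obtain ⟨b, -, hb⟩ := exists_adj_mem_of_pathIn_ne ((hconn a ha).symm) hac
    exact ⟨b, hb⟩
  · obtain ⟨b, -, hb⟩ := exists_adj_mem_of_pathIn_ne (hconn u hu) (Ne.symm huc)
    exact ⟨b, hb⟩

end Skelφ

end Transplant

end Summit.CriticalPhenomena.PercolationContinuityZ3.Theorems

end
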